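import Summits.AnomalousDissipation.AnomalousDissipation.Theorems.SawtoothPulseCascadeK1LocalisedCascadeOscPhase4Sharp
import Summits.AnomalousDissipation.AnomalousDissipation.Theorems.SawtoothPulseCascadeK1LocalisedCascadeOscPhase5Sharp
import Summits.AnomalousDissipation.AnomalousDissipation.Theorems.SawtoothPulseCascadeK1LocalisedCascadeOscPhase6Sharp
import Summits.AnomalousDissipation.AnomalousDissipation.Theorems.SawtoothPulseCascadeK1LocalisedCascadeOscPhase7Sharp
import Summits.AnomalousDissipation.AnomalousDissipation.Theorems.SawtoothPulseCascadeK1LocalisedCascadeOscPhase8Sharp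
import Summits.AnomalousDissipation.AnomalousDissipation.Theorems.SawtoothPulseCascadeK1LocalisedCascadeOscPhase9Sharp
import Summits.AnomalousDissipation.AnomalousDissipation.Theorems.SawtoothPulseCascadeK1LocalisedCascadeOscPhase10Sharp

/-!
# K1loc — THE FAT OSCILLATORY SEGMENT RE-CERTIFIED AT `δ* = 2⁻¹⁰⁰`: `E₁₁ ≤ E₄ + (0.1286 + 0.2424·o₄)`, `o₁₁ ≤ 0.0014`

Prover lane on the crux `K1LocalisedCascade` (stmt-AnomalousDissipation-19491), route `SawtoothPulseCascade`
(S-B/S-C assembly seat; the LEDGER ASSEMBLY).  Companion of `…OscFatSegment` (certified at `δ* = 2⁻⁵⁰`: `0.1453 + 0.2488·o₄`): the same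
composition of the certified fat phases, now `…OscPhase4Sharp` … `…OscPhase10Sharp` (`δ₀ ≤ 2⁻¹⁰⁰`, the hypothesis the thin tail needs
anyway; zone terms vanish, finer rounding):
  **`fat_segment_osc_sharp_le_11`**: `S₁₁(K₁₁) + O₁₁(K₁₁) ≤ S₄(K₄) + O₄(K₄) + (0.1286 + 0.2424·o)` for any `o ≥ √O₄(K₄)`, `o ≥ 0`, and
  `√O₁₁(K₁₁) ≤ 0.0014` (`K₄ = 500000`, `K₁₁ = 800·25⁹`).
No definitions; no statement about the crux. [cite: Grafakos2014, Prop. 3.1.2 (5), Prop. 3.2.7 (3), §3.1.3] [problem: turb]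
-/

-- `Summit.<Summit>.<Problem>`: single-conjunct summit, the duplicate namespace segment is deliberate.
set_option linter.dupNamespace false

noncomputable section

namespace Summit.AnomalousDissipation.AnomalousDissipation.Theorems.SawtoothPulseCascade.K1Window

open MeasureTheory Set Filter Topology UnitAddTorus Function Complex Metric
open scoped Real ENNReal
open Literature.Analysis Literature.Analysis.FunctionSpaces Literature.Analysis.FunctionSpaces.Torus Literature.Analysis.FluidPDE
open Literature.Analysis.FluidPDE.ShearStage
open Literature.Analysis.FluidPDE.SawtoothCascade Literature.Analysis.FluidPDE.SawtoothCascade.CascadeParams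

section Cascade

variable (P : CascadeParams)

set_option maxHeartbeats 400000 in
/-- **THE FAT SEGMENT UP TO PHASE 11** (see the file header): `E_11 ≤ E_4 + (0.1286 + 0.2424·o)` for every `o ≥ √O_4(K_4)`, `o ≥ 0`, and
`√O_11(K_11) ≤ 0.0014`. [cite: Grafakos2014, Prop. 3.1.2 (5), Prop. 3.2.7 (3), §3.1.3] -/
theorem fat_segment_osc_sharp_le_11 (hγ : P.γ = 8) (hδ₀ : 0 < P.δ₀) (hδ₀' : P.δ₀ ≤ (2 : ℝ)⁻¹ ^ 100) (hd : P.d = 2) (hN₀ : P.N₀ = 1)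
    (hρN : P.ρN = 2) (a b : ℕ → UnitAddTorus (Fin 2) → ℝ) (has : ∀ j, IsSmooth (a j)) (h0 : a 0 = datum)
    (hb : ∀ j, b j = a j ∘ shearMap 0 1 (amp ⟨P.U j, P.U_periodic j, P.contDiff_U (P.δ_pos hδ₀ (by rw [hd]; norm_num) j)⟩ P.γ))
    (hab : ∀ j, a (j + 1) = b j ∘ shearMap 1 0 (amp ⟨P.U j, P.U_periodic j, P.contDiff_U (P.δ_pos hδ₀ (by rw [hd]; norm_num) j)⟩ P.γ))
    {o : ℝ} (ho0 : 0 ≤ o)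
    (ho : Real.sqrt (∑' k : Fin 2 → ℤ, (if ((500000 : ℕ) : ℤ) ≤ |k 0| ∧ ((1 : ℕ) : ℤ) * |k 0| ≤ ((4 : ℕ) : ℤ) * |k 1| then (1 : ℝ) else 0) *
          ‖mFourierCoeff (fun x => (a 4 x : ℂ)) k‖ ^ 2) ≤ o) :
    ∑' k : Fin 2 → ℤ, (if |k 0| < ((3051757812500000 : ℕ) : ℤ) then (1 : ℝ) else 0) * ‖mFourierCoeff (fun x => (a 11 x : ℂ)) k‖ ^ 2 +
        ∑' k : Fin 2 → ℤ, (if ((3051757812500000 : ℕ) : ℤ) ≤ |k 0| ∧ ((1 : ℕ) : ℤ) * |k 0| ≤ ((4 : ℕ) : ℤ) * |k 1| then (1 : ℝ) else 0) *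
          ‖mFourierCoeff (fun x => (a 11 x : ℂ)) k‖ ^ 2 ≤
      ∑' k : Fin 2 → ℤ, (if |k 0| < ((500000 : ℕ) : ℤ) then (1 : ℝ) else 0) * ‖mFourierCoeff (fun x => (a 4 x : ℂ)) k‖ ^ 2 +
        ∑' k : Fin 2 → ℤ, (if ((500000 : ℕ) : ℤ) ≤ |k 0| ∧ ((1 : ℕ) : ℤ) * |k 0| ≤ ((4 : ℕ) : ℤ) * |k 1| then (1 : ℝ) else 0) *
          ‖mFourierCoeff (fun x => (a 4 x : ℂ)) k‖ ^ 2 + (0.1286 + 0.2424 * o) ∧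
    Real.sqrt (∑' k : Fin 2 → ℤ, (if ((3051757812500000 : ℕ) : ℤ) ≤ |k 0| ∧ ((1 : ℕ) : ℤ) * |k 0| ≤ ((4 : ℕ) : ℤ) * |k 1| then (1 : ℝ) else 0) *
          ‖mFourierCoeff (fun x => (a 11 x : ℂ)) k‖ ^ 2) ≤ 0.0014 := by
  obtain ⟨h4, o5⟩ := resolved_step_osc_phase4_sharp P hγ hδ₀ hδ₀' hd hN₀ hρN a b has h0 hb hab ho0 ho
  obtain ⟨h5, o6⟩ := resolved_step_osc_phase5_sharp P hγ hδ₀ hδ₀' hd hN₀ hρN a b has h0 hb hab (by norm_num) o5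
  obtain ⟨h6, o7⟩ := resolved_step_osc_phase6_sharp P hγ hδ₀ hδ₀' hd hN₀ hρN a b has h0 hb hab (by norm_num) o6
  obtain ⟨h7, o8⟩ := resolved_step_osc_phase7_sharp P hγ hδ₀ hδ₀' hd hN₀ hρN a b has h0 hb hab (by norm_num) o7
  obtain ⟨h8, o9⟩ := resolved_step_osc_phase8_sharp P hγ hδ₀ hδ₀' hd hN₀ hρN a b has h0 hb hab (by norm_num) o8
  obtain ⟨h9, o10⟩ := resolved_step_osc_phase9_sharp P hγ hδ₀ hδ₀' hd hN₀ hρN a b has h0 hb hab (by norm_num) o9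
  obtain ⟨h10, o11⟩ := resolved_step_osc_phase10_sharp P hγ hδ₀ hδ₀' hd hN₀ hρN a b has h0 hb hab (by norm_num) o10
  have hnum : (0.1024 : ℝ) + (0.0105 + 0.0686 * 0.1932) + (0.000934 + 0.0194 * 0.0635) + (0.000092 + 0.0056 * 0.0193) +
      (0.000013 + 0.0016 * 0.0062) + (0.000005 + 0.0006 * 0.0024) + (0.000004 + 0.0002 * 0.0015) ≤ 0.1286 := by norm_num
  exact ⟨by linarith [h4, h5, h6, h7, h8, h9, h10], o11⟩

end Cascade

end Summit.AnomalousDissipation.AnomalousDissipation.Theorems.SawtoothPulseCascade.K1Window
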